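import Summits.ResolutionOfSingularities.ResolutionOfSingularities.Theorems.FrobeniusLadderFRationalResolutionToricStalks
import Summits.ResolutionOfSingularities.ResolutionOfSingularities.Theorems.FrobeniusLadderFRationalResolutionIsolatedGlue
import HarnessLib

/-!
# Crux `FrobeniusLadder.FRationalResolution` (stmt-ResolutionOfSingularities-15317), line `redirect`,
# stub `stub_diagonalizableQuotientResolution` — varieties with TORIC SURFACE singular germs are
# resolvable over every field (no F-rationality, no characteristic, no dimension hypothesis)

The c5 lead's `hasResolution_fRational_surface_of_toric_stalks` (`…ToricStalks.lean`) resolves an integral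
surface of characteristic `p` whose stalks are F-rational and whose singular stalks are vertex germs of
affine toric surfaces `U(r,a) = Spec k[σ∨ ∩ ℤ²]` (the cyclic quotient surface singularities, every
field); the F-rational clause and `dim X ≤ 2` enter only to make the singular locus finite. With the
dimension-free gluing `IsolatedGlue.hasResolution_of_finite_singularLocus_of_local` (this generation)
and the lead's `local_resolution_of_toric_stalk` (any field) the hypotheses reduce to finiteness of the
singular locus:

* `hasResolution_of_toricSurface_stalks` — **an integral `X` locally of finite type over ANY field,
  with finitely many singular points each of whose local rings is `k`-isomorphic to the vertex local
  ring of some `U(r,a)` (`a < r`), has a resolution of singularities.**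

Honest label: Zariski-local toric surface germs (the complete list of 2-dimensional diagonalizable
quotient singularities up to such germs is the classification `(1/r)(1,a)`, not formalised here); the
stub's étale charts need the descent step instead. No definitions, no named facts, no sorry.
[folklore; cite: Kollar2007, §2.2; CoxLittleSchenck2011, Thm. 10.1.10]
-/

-- single-problem summit: the doubled namespace component is forced
set_option linter.dupNamespace false

noncomputable section

namespace Summit.ResolutionOfSingularities.ResolutionOfSingularities.Theorems.FRationalResolution

open CategoryTheory AlgebraicGeometry TopologicalSpace
open Literature.AlgebraicGeometry.Resolution

section Toric

variable (k : Type) [Field k]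

/-- The Laurent polynomial ring `k[ℤ²]` (coordinate ring of the 2-torus). -/
local notation3 "Lk" => AddMonoidAlgebra k (ℤ × ℤ)

/-- The lattice points of the dual cone `σ∨ = {m₂ ≥ 0, a m₂ ≤ r m₁}` of `σ = cone((0,1),(r,-a))`. -/
local notation3 "σS[" r ", " a "]" =>
  {m : ℤ × ℤ | 0 ≤ m.2 ∧ ((a : ℕ) : ℤ) * m.2 ≤ ((r : ℕ) : ℤ) * m.1}

/-- The toric surface algebra `k[σ∨ ∩ ℤ²] ⊆ k[ℤ²]`. -/
local notation3 "TA[" r ", " a "]" =>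
  Algebra.adjoin k ((fun m : ℤ × ℤ => AddMonoidAlgebra.single m (1 : k)) '' σS[r, a])

namespace ToricSurfaceStalks

/-- **VARIETIES WITH TORIC SURFACE SINGULAR GERMS ARE RESOLVABLE (every field).** Let `X` be an
integral scheme locally of finite type over a field `k` whose singular locus is finite, and suppose
that at every singular point `s` the local ring `𝒪_{X,s}` is `k`-isomorphic to the local ring of some
affine toric surface `U(r,a) = Spec TA[r,a]` (`a < r`) at its vertex (the point where `x = χ^(1,0)` and
`w = χ^(a,r)` vanish), compatibly with the structure maps. Then `X` has a resolution of singularities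
(`local_resolution_of_toric_stalk` at each singular point, glued by
`IsolatedGlue.hasResolution_of_finite_singularLocus_of_local`).
[folklore; cite: Kollar2007, §2.2; CoxLittleSchenck2011, Thm. 10.1.10] -/
theorem hasResolution_of_toricSurface_stalks (X : Scheme.{0}) [IsIntegral X] (f : X ⟶ Spec (.of k))
    [LocallyOfFiniteType f] (hfin : (Scheme.regularLocus X)ᶜ.Finite)
    (hstalk : ∀ s : X, s ∉ Scheme.regularLocus X → ∃ (r a : ℕ) (_ : a < r) (x w : ↥TA[r, a])
      (_ : (x : Lk) = AddMonoidAlgebra.single ((1 : ℤ), (0 : ℤ)) 1)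
      (_ : (w : Lk) = AddMonoidAlgebra.single ((a : ℤ), (r : ℤ)) 1)
      (q : Spec (CommRingCat.of ↥TA[r, a])) (_ : x ∈ q.asIdeal ∧ w ∈ q.asIdeal)
      (e : (Spec (CommRingCat.of ↥TA[r, a])).presheaf.stalk q ≅ X.presheaf.stalk s),
      Spec.map e.hom ≫ (Spec (CommRingCat.of ↥TA[r, a])).fromSpecStalk q ≫
        Spec.map (CommRingCat.ofHom (algebraMap k ↥TA[r, a])) = X.fromSpecStalk s ≫ f) :
    Scheme.HasResolution X := by
  refine IsolatedGlue.hasResolution_of_finite_singularLocus_of_local k X f hfin fun s hs => ?_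
  obtain ⟨r, a, har, x, w, hx, hw, q, hq, e, he⟩ := hstalk s hs
  exact local_resolution_of_toric_stalk k X f s hs r a har x w hx hw q hq e he

end ToricSurfaceStalks

end Toric

end Summit.ResolutionOfSingularities.ResolutionOfSingularities.Theorems.FRationalResolution

end
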